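import Summits.AtomisticToContinuum.Crystallization.Theorems.ChartedZeroExcessLayeredLatticeLiouvilleZZZM
import Summits.AtomisticToContinuum.Crystallization.Theorems.ChartedZeroExcessLayeredLatticeLiouvilleZZZH

/-!
(SPLIT FOR THE 400-LINE CAP by the landing lane, hand-2 g40: this file = part 1 of 2; sequels `…ChartedZeroExcessLayeredLatticeLiouvilleZZZN` import it in a chain; same namespace, all FQNs unchanged.)
# (CV₂-split) ZZZN — BOND-LABEL COVERING (CV₂♮) PROVED AT THE RECORD DIALS FROM (CC): every deep site is the label of a core atom (lens-2 g83)

Lineage `stmt-AtomisticToContinuum-26636` (route ChartedPlanarOrder, sub Crystallization), lens-2 «structural dichotomy (special vs generic)» g83,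
critic row 1524 ORDER ② «(CV₂) by counting/injectivity once ① stands».  The docket's (CV₂) `LabelCoveringP₂` asks, for EVERY variant label, that
every deep site `c ∈ C` (`dist(c, k) ≤ rI` for some `k ∈ K`) be the label of an atom of `coreOf S K rm`.  After ZZZM the label the docket consumes is
THE canonical bond label (unique by (BU₂)); this file proves covering for BOND labels:

* §1 `exists_atom_toward'` — ZZD's «atom toward any direction» at the SHADOW-CRYSTAL cleanliness `(1/15, 8999/10000)` (tree ZZZH transfers `H`'s
  `(1/16, 9/10, 1)`-cleanliness to `C` only at these constants); §2 the outward cone walk of ZZZM for a chart of `C` (`exists_path_outward'`);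
  §3 `placedCrystal_good` — every site of the placed crystal of a cool shadow crystal of a clean `H` is `(1/15, 8999/10000, 1)`-good
  (tree ZZZH `isTwoShellGoodSet_of_envClose_record`, transported through the placing isometry, `isTwoShellGoodSet_placed`).
* §4 `IsStarHom.exists_link_preimage` — LINK SURJECTIVITY: a star homomorphism hits every neighbour of the image centre (rider ZZZL: injective
  `Fin 12 → Fin 12` is onto).
* §5 ★★★ `exists_zone_preimage_of_bondLabel` / `exists_core_preimage_of_bondLabel` — THE PATH-LIFTING ARGUMENT: from a deep site `c` walk OUTWARD in
  `C` (cone walk, potential `dist(Φ ·, x₀)`) to a site `Φ z` with `rI < dist(Φ z, k)` for all `k` — there REG-in (clause (v) of `IsCoolShadowCrystal`)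
  provides an atom within `ε`, which is a COOL zone atom, so its label is `Φ z` (collar clause (iv) + separation of `C`); then LIFT the reversed walk
  step by step: the current atom's closed star lies in the zone (LOCALISATION FOR FREE: a zone atom is either cool — then within `ε` of its label —
  or warm — then within `rΘ + q` of `x₀`), so the label is a star homomorphism there and link surjectivity produces a bonded atom labelled by the
  next site.  The end atom `p` has `lab p = c`; it lies in `coreOf S K rm` because an atom farther than `rm ≥ rΘ` from all of `K` is cool and then
  within `ε` of its deep label (`rI + ε ≤ rm`).  Dial inequality: `rI + 2q + 2·(28/25) + ε < ℓ` (`20.2401 < 21.5`), `rΘ + ε ≤ rI`.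
* §6 the piece **(CV₂♮) `BondLabelCoveringP₂`** (binder telescope of ZZZD verbatim, conclusion of (CV₂) for BOND labels) PROVED at the record dials
  from (CC) (`bondLabelCoveringP₂_of_placedCrystalChartP`); the (OC) junction and the DOCKET SLOT re-cut to consume (CBL₂) ∧ (AR₂) ∧ (LN₂) ∧ (CV₂♮)
  (`coreOccupancyP_of_coherentBondLabel₂`, `coolMoatSlavedFillingP_tubeSlot_of_coherentBondLabel₂'`), and the record slot with (CV₂♮) DISCHARGED by
  (CC): `coolMoatSlavedFillingP_tubeSlot_of_placedCrystalChartP` ⟸ (CC) ∧ (SC) ∧ (CBL₂) ∧ (AR₂) ∧ (LN₂) ∧ (X1) ∧ (X2ᴸ♮) — once ZZZK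
  (`placedCrystalChartP_record`) lands, (GL₂), (BU₂), (CV₂♮) are all unconditional and the generic side of the docket is (CBL₂) ∧ (AR₂) ∧ (LN₂).

TAGS: (CV₂♮) KINEMATIC · COMBINATORIAL · PROVED@record from (CC) (this file).  (CV₂) as typed (∀ VARIANT labels, no bond structure) is NOT claimed and
no longer consumed.  Why (CV₂♮) might have failed: a deep site reachable from the cool shell only through sites whose lifted atoms leave the zone
(excluded: lifted atoms are localised by cool-or-warm), or a label that is a star homomorphism but misses a neighbour (excluded by counting, §4).
Sources: tree ZZD/ZZX/ZZZG/ZZZH/YZ/ZC, riders ZZZL/ZZZM; Conway–Sloane SPLAG ch. 4.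

0 sorry; imports = rider ZZZM (after ZZZL) + tree ZZZH; axioms standard.
-/

noncomputable section

open scoped BigOperators Classical InnerProductSpace RealInnerProductSpace
open MeasureTheory Set Metric Filter Topology
open Literature.Geometry.DiscreteGeometry (IsTwoShellGoodSet fccTwoShellPattern hcpTwoShellPattern)
open Literature.MathematicalPhysics.StatisticalMechanics (lennardJones)

namespace Summit.AtomisticToContinuum.Crystallization.Theorems.ChartedZeroExcessLayeredLatticeLiouville

open Summit.AtomisticToContinuum.Crystallization.Theorems.ChartedPlanarOrderRigidityDoor (E3 IsClean)
open Summit.AtomisticToContinuum.Crystallization.Theorems.ChartedPlanarOrderDensityDichotomy (μS IsSep)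
open Summit.AtomisticToContinuum.Crystallization.Theorems.ChartedPlanarOrderCleanScaleP (IsCleanP IsDoorSetP isCleanP_μS_iff)
open Summit.AtomisticToContinuum.Crystallization.Theorems.ChartedPlanarOrderMesoCut (LayeredHom EnvClose)
open Summit.AtomisticToContinuum.Crystallization.Theorems.ChartedPlanarOrderDoorLayeredOsc (IsTwoShellAffineGood)

/-! ### ZZZN-1  An atom toward any direction at cleanliness `(1/15, 8999/10000)` -/

/-- ★ ZZD's `exists_atom_toward` at the shadow-crystal constants: at a `(1/15, 8999/10000, aHi)`-two-shell-good site `p` of `Y`, for every `w ≠ 0`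
there is `n ∈ Y` with `0 < dist n p ≤ 16/15·aHi` and `∠(n − p, w) ≤ 60°` (`½(1 + 1/15) + 1/15 = 0.6 ≤ 1/1.42`). [this file, g83] -/
theorem exists_atom_toward' {aHi : ℝ} {Y : Set E3} {p : E3} (hgood : IsTwoShellGoodSet (1 / 15) (8999 / 10000) aHi Y p) {w : E3}
    (hw : w ≠ 0) : ∃ n ∈ Y, 0 < dist n p ∧ dist n p ≤ 16 / 15 * aHi ∧ (1 / 2) * (‖n - p‖ * ‖w‖) ≤ ⟪n - p, w⟫_ℝ := by
  obtain ⟨a, ha9, haHi, A, P, f, hP, hf, -, -⟩ := hgood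
  have ha0 : 0 < a := by linarith
  have hs2 : 0 < Real.sqrt 2 := Real.sqrt_pos.2 (by norm_num)
  obtain ⟨w₀, hw₀'⟩ := (A.toLinearIsometryEquiv rfl).surjective w
  have hw₀ : A w₀ = w := by rw [← hw₀', LinearIsometry.toLinearIsometryEquiv_apply]
  have hnw : ‖w‖ = ‖w₀‖ := by rw [← hw₀, A.norm_map]
  obtain ⟨v, hvP, hv1, hvw⟩ := exists_kissing_toward hP w₀
  obtain ⟨hnS, hne⟩ := hf v hvP
  have hAvw : ⟪A v, w⟫_ℝ = ⟪v, w₀⟫_ℝ := by rw [← hw₀, A.inner_map_map]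
  obtain ⟨e, he⟩ : ∃ e : E3, e = f v - (p + a • A v) := ⟨_, rfl⟩
  have henorm : ‖e‖ ≤ 1 / 15 * a := by rw [he, ← dist_eq_norm]; exact hne
  have hdecomp : f v - p = a • A v + e := by rw [he]; abel
  have hAv : ‖a • A v‖ = a := by rw [norm_smul, Real.norm_of_nonneg ha0.le, A.norm_map, hv1, mul_one]
  have hup : ‖f v - p‖ ≤ 16 / 15 * a := by
    rw [hdecomp]
    calc ‖a • A v + e‖ ≤ ‖a • A v‖ + ‖e‖ := norm_add_le _ _
      _ ≤ a + 1 / 15 * a := add_le_add hAv.le henorm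
      _ = 16 / 15 * a := by ring
  have hlo : 14 / 15 * a ≤ ‖f v - p‖ := by
    rw [hdecomp]
    have h := norm_sub_le (a • A v + e) e
    rw [add_sub_cancel_right, hAv] at h
    linarith
  have hI0 : 0 ≤ ⟪v, w₀⟫_ℝ := by
    by_contra h
    have h' : Real.sqrt 2 * ⟪v, w₀⟫_ℝ < 0 := mul_neg_of_pos_of_neg hs2 (lt_of_not_ge h)
    linarith [norm_nonneg w₀]
  have hI : ‖w‖ ≤ 142 / 100 * ⟪v, w₀⟫_ℝ := by
    rw [hnw]; exact hvw.trans (mul_le_mul_of_nonneg_right sqrt_two_lt_142.le hI0)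
  have hew : -(1 / 15 * a * ‖w‖) ≤ ⟪e, w⟫_ℝ := by
    have h1 := neg_le_of_abs_le (abs_real_inner_le_norm e w)
    have h2 : ‖e‖ * ‖w‖ ≤ 1 / 15 * a * ‖w‖ := mul_le_mul_of_nonneg_right henorm (norm_nonneg _)
    linarith
  refine ⟨f v, hnS, ?_, ?_, ?_⟩
  · rw [dist_eq_norm]; linarith
  · rw [dist_eq_norm]; exact hup.trans (by linarith)
  · calc (1 / 2) * (‖f v - p‖ * ‖w‖) ≤ (1 / 2) * (16 / 15 * a * ‖w‖) := by gcongr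
      _ ≤ a * ⟪v, w₀⟫_ℝ - 1 / 15 * a * ‖w‖ := by
          nlinarith [mul_nonneg ha0.le (sub_nonneg.2 hI), mul_nonneg ha0.le (norm_nonneg w)]
      _ ≤ a * ⟪v, w₀⟫_ℝ + ⟪e, w⟫_ℝ := by linarith
      _ = ⟪f v - p, w⟫_ℝ := by rw [hdecomp, inner_add_left, real_inner_smul_left, hAvw]

/-! ### ZZZN-2  Outward cone walks in a charted `(1/15, 8999/10000, 1)`-clean set -/

/-- ★ a Barlow step toward any direction in a globally charted `(1/15, 8999/10000, 1)`-clean set. [this file, g83] -/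
theorem exists_barlowAdj_toward' {C : Set E3} {Φ : ℤ × ℤ × ℤ → E3} {τ : ℤ → Bool}
    (hΦ : IsBarlowBondChart C Set.univ Φ τ) (hsurjΦ : ∀ c ∈ C, ∃ y, Φ y = c)
    (hclean : ∀ c ∈ C, IsTwoShellGoodSet (1 / 15) (8999 / 10000) 1 C c) (y : ℤ × ℤ × ℤ) {w : E3} (hw : w ≠ 0) :
    ∃ y' : ℤ × ℤ × ℤ, BarlowAdj τ y y' ∧ 0 < dist (Φ y') (Φ y) ∧ dist (Φ y') (Φ y) ≤ 16 / 15 ∧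
      1 / 2 * (‖Φ y' - Φ y‖ * ‖w‖) ≤ ⟪Φ y' - Φ y, w⟫_ℝ := by
  have hyC : Φ y ∈ C := hΦ.2.1 (mem_univ y)
  obtain ⟨n, hnC, hpos, hle, hcone⟩ := exists_atom_toward' (hclean _ hyC) hw
  obtain ⟨y', rfl⟩ := hsurjΦ n hnC
  refine ⟨y', ?_, hpos, by linarith, hcone⟩
  have hb : IsBond (Φ y) (Φ y') := ⟨by rwa [dist_comm], by rw [dist_comm]; linarith⟩
  exact (hΦ.2.2 y (mem_univ _) y' (mem_univ _)).1 hb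

/-- a Barlow step strictly AWAY from `x₀`. [this file, g83] -/
theorem exists_barlowAdj_farther' {C : Set E3} {Φ : ℤ × ℤ × ℤ → E3} {τ : ℤ → Bool}
    (hΦ : IsBarlowBondChart C Set.univ Φ τ) (hsurjΦ : ∀ c ∈ C, ∃ y, Φ y = c)
    (hclean : ∀ c ∈ C, IsTwoShellGoodSet (1 / 15) (8999 / 10000) 1 C c) (a : ℤ × ℤ × ℤ) (x₀ : E3) :
    ∃ a' : ℤ × ℤ × ℤ, BarlowAdj τ a a' ∧ dist (Φ a) x₀ < dist (Φ a') x₀ ∧ dist (Φ a') (Φ a) ≤ 28 / 25 := by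
  by_cases h : Φ a = x₀
  · have hb : IsBond (Φ a) (Φ (linkPt τ a 0)) :=
      (hΦ.2.2 a (mem_univ _) _ (mem_univ _)).2 (barlowAdj_linkPt τ a 0)
    refine ⟨linkPt τ a 0, barlowAdj_linkPt τ a 0, ?_, by rw [dist_comm]; exact hb.2⟩
    rw [h, dist_self, ← h, dist_comm]
    exact hb.1
  · have hw : Φ a - x₀ ≠ 0 := sub_ne_zero.2 h
    obtain ⟨a', hadj, hpos, hle, hcone⟩ := exists_barlowAdj_toward' hΦ hsurjΦ hclean a hw
    refine ⟨a', hadj, ?_, by linarith⟩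
    rw [dist_eq_norm] at hpos
    rw [dist_eq_norm, dist_eq_norm]
    have hsq : ‖Φ a' - x₀‖ ^ 2 = ‖Φ a' - Φ a‖ ^ 2 + 2 * ⟪Φ a' - Φ a, Φ a - x₀⟫ + ‖Φ a - x₀‖ ^ 2 := by
      rw [← norm_add_sq_real]; congr 1; abel
    have hlt : ‖Φ a - x₀‖ ^ 2 < ‖Φ a' - x₀‖ ^ 2 := by
      rw [hsq]
      nlinarith [mul_pos hpos hpos, mul_nonneg (norm_nonneg (Φ a' - Φ a)) (norm_nonneg (Φ a - x₀)), hcone]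
    exact lt_of_pow_lt_pow_left₀ 2 (norm_nonneg _) hlt

/-- ★ THE OUTWARD WALK in a charted `(1/15, 8999/10000, 1)`-clean separated set (ZZZM `exists_path_outward` verbatim). [this file, g83] -/
theorem exists_path_outward' {C : Set E3} {Φ : ℤ × ℤ × ℤ → E3} {τ : ℤ → Bool} {x₀ : E3} {δ G : ℝ}
    (hΦ : IsBarlowBondChart C Set.univ Φ τ) (hsurjΦ : ∀ c ∈ C, ∃ y, Φ y = c)
    (hclean : ∀ c ∈ C, IsTwoShellGoodSet (1 / 15) (8999 / 10000) 1 C c) (hδ : 0 < δ) (hsep : IsSep δ C)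
    {x : ℤ × ℤ × ℤ} (hx : dist (Φ x) x₀ ≤ G + 28 / 25) :
    ∃ z : ℤ × ℤ × ℤ, G < dist (Φ z) x₀ ∧ dist (Φ z) x₀ ≤ G + 28 / 25 ∧
      Relation.ReflTransGen
        (fun a b => dist (Φ a) x₀ ≤ G + 28 / 25 ∧ dist (Φ b) x₀ ≤ G + 28 / 25 ∧ BarlowAdj τ a b) x z := by
  classical
  have hfin : Set.Finite {y : ℤ × ℤ × ℤ | ∃ k ∈ ({x₀} : Set E3), dist (Φ y) k ≤ G + 28 / 25} :=
    finite_chartSites_near_univ (K := ({x₀} : Set E3)) (q := 0) hδ hsep hΦ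
      (fun k hk => by rw [mem_singleton_iff.1 hk, dist_self])
  have key := exists_path_to_goal
    (fun a b => dist (Φ a) x₀ ≤ G + 28 / 25 ∧ dist (Φ b) x₀ ≤ G + 28 / 25 ∧ BarlowAdj τ a b)
    {a | dist (Φ a) x₀ ≤ G + 28 / 25} (fun a => G < dist (Φ a) x₀) (fun a => -dist (Φ a) x₀) hfin.toFinset
    (fun a ha => hfin.mem_toFinset.2 ⟨x₀, mem_singleton x₀, ha⟩) ?_ x hx
  · obtain ⟨z, hz, hgz, hpath⟩ := key
    exact ⟨z, hgz, hz, hpath⟩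
  intro a ha hga
  push Not at hga
  obtain ⟨a', hadj, hlt, hlen⟩ := exists_barlowAdj_farther' hΦ hsurjΦ hclean a x₀
  have ha' : dist (Φ a') x₀ ≤ G + 28 / 25 := by linarith [dist_triangle (Φ a') (Φ a) x₀]
  exact ⟨a', ha', ⟨ha, ha', hadj⟩, by linarith⟩

/-! ### ZZZN-3  The placed crystal of a cool shadow crystal is `(1/15, 8999/10000, 1)`-clean -/

/-- two-shell goodness is transported by the placing isometry `v ↦ U⁻¹ v + t`. [this file, g83] -/
theorem isTwoShellGoodSet_placed {θ lo hi : ℝ} {Y : Set E3} {q : E3} (U : E3 ≃ₗᵢ[ℝ] E3) (t : E3)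
    (h : IsTwoShellGoodSet θ lo hi Y q) : IsTwoShellGoodSet θ lo hi {c | U (c - t) ∈ Y} (U.symm q + t) := by
  obtain ⟨a, ha₁, ha₂, A, P, f, hP, hf, hinj, hcov⟩ := h
  refine ⟨a, ha₁, ha₂, U.symm.toLinearIsometry.comp A, P, fun w => U.symm (f w) + t, hP, fun w hw => ⟨?_, ?_⟩,
    fun w hw w' hw' he => hinj hw hw' (U.symm.injective (add_right_cancel he)), ?_⟩
  · show U (U.symm (f w) + t - t) ∈ Y
    simpa using (hf w hw).1
  · have e1 : U.symm q + t + a • (U.symm.toLinearIsometry.comp A) w = U.symm (q + a • A w) + t := by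
      simp only [LinearIsometry.coe_comp, Function.comp_apply, LinearIsometryEquiv.coe_toLinearIsometry, map_add, map_smul]
      abel
    show dist (U.symm (f w) + t) (U.symm q + t + a • (U.symm.toLinearIsometry.comp A) w) ≤ θ * a
    rw [e1, dist_add_right, LinearIsometryEquiv.dist_map]
    exact (hf w hw).2
  · intro y hy hne hd
    have hy₀ : U (y - t) ∈ Y := hy
    have hyeq : U.symm (U (y - t)) + t = y := by simp
    have hne₀ : U (y - t) ≠ q := fun e => hne (by rw [← hyeq, e])
    have hdd : dist (U (y - t)) q = dist y (U.symm q + t) :=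
      calc dist (U (y - t)) q = dist (U.symm (U (y - t))) (U.symm q) := (U.symm.dist_map _ _).symm
        _ = dist (y - t) (U.symm q) := by rw [U.symm_apply_apply]
        _ = dist (y - t + t) (U.symm q + t) := (dist_add_right _ _ _).symm
        _ = dist y (U.symm q + t) := by rw [sub_add_cancel]
    obtain ⟨v, hv, hfv⟩ := hcov _ hy₀ hne₀ (by rw [hdd]; exact hd)
    exact ⟨v, hv, by simp only [hfv, hyeq]⟩

/-- ★ every site of the placed crystal `C = placedCrystal L' w' U t` of a `(17/20)`-separated model `H₀ = LayeredHom L' w'`, two-sidedly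
`(10⁻⁴, 5)`-shadowed by a CLEAN `H`, is `(1/15, 8999/10000, 1)`-good in `C` (tree ZZZH at `H₀`, transported). [this file, g83] -/
theorem placedCrystal_good {H : Set E3} (hH : IsClean (μS H)) {L' : E3 →L[ℝ] E3} {w' : ℤ → E3} (U : E3 ≃ₗᵢ[ℝ] E3) (t : E3)
    (hsep : IsSep (17 / 20) (LayeredHom L' w'))
    (hsh : ∀ x' ∈ LayeredHom L' w', ∃ x ∈ H, EnvClose (1 / 10000) 5 (LayeredHom L' w') x' H x) :
    ∀ c ∈ placedCrystal L' w' U t, IsTwoShellGoodSet (1 / 15) (8999 / 10000) 1 (placedCrystal L' w' U t) c := by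
  intro c hc
  have hx' : U (c - t) ∈ LayeredHom L' w' := hc
  obtain ⟨x, hx, hE⟩ := hsh _ hx'
  have hg := isTwoShellGoodSet_placed U t
    (isTwoShellGoodSet_of_envClose_record ((isCleanP_μS_iff (aHi := 1) H).1 hH x hx) hsep hx' hE)
  have e : U.symm (U (c - t)) + t = c := by simp
  rw [e] at hg
  exact hg

/-! ### ZZZN-4  Link surjectivity of a star homomorphism -/

/-- ★ LINK SURJECTIVITY: a star homomorphism at `y` hits EVERY neighbour of `f y` by a link site of `y` (its code permutation `Fin 12 → Fin 12` is
injective, hence onto). [this file, g83] -/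
theorem IsStarHom.exists_link_preimage {τ τ' : ℤ → Bool} {f : ℤ × ℤ × ℤ → ℤ × ℤ × ℤ} {y : ℤ × ℤ × ℤ} (h : IsStarHom τ τ' f y)
    {y' : ℤ × ℤ × ℤ} (hy' : BarlowAdj τ' (f y) y') : ∃ i, f (linkPt τ y i) = y' := by
  choose c hc using fun i => exists_linkPt_of_barlowAdj (h.1 i)
  have hcinj : Function.Injective c := fun a b hab => h.2.2 (by simp only [hc, hab])
  obtain ⟨j, rfl⟩ := exists_linkPt_of_barlowAdj hy'
  obtain ⟨i, hi⟩ := Finite.surjective_of_injective hcinj j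
  exact ⟨i, by rw [hc, hi]⟩

/-! ### ZZZN-5  ★★★ Path lifting: every deep site is the label of a zone atom, which is a core atom -/

/-- ★★★ **EVERY DEEP SITE IS THE LABEL OF A ZONE ATOM** (pointwise form; see the module docstring for the walk-out / lift-back argument).
[this file, g83] -/
theorem exists_zone_preimage_of_bondLabel {S K C : Set E3} {Ψ Φ : ℤ × ℤ × ℤ → E3} {τS τC : ℤ → Bool} {x₀ : E3}
    {σC ε rΘ rI ℓ q : ℝ} {lab : E3 → E3}
    (hΨ : IsBarlowBondChart S Set.univ Ψ τS) (hsurjΨ : ∀ p ∈ S, ∃ x, Ψ x = p)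
    (hΦ : IsBarlowBondChart C Set.univ Φ τC) (hsurjΦ : ∀ c ∈ C, ∃ y, Φ y = c)
    (hcleanC : ∀ c ∈ C, IsTwoShellGoodSet (1 / 15) (8999 / 10000) 1 C c) (hσ : 0 < σC) (hsepC : IsSep σC C)
    (hε₀ : 0 ≤ ε) (hε : 2 * ε < σC) (hKq : ∀ k ∈ K, dist k x₀ ≤ q) (hrΘ : rΘ + ε ≤ rI)
    (hdial : rI + 2 * q + 2 * (28 / 25) + ε < ℓ)
    (hin : ∀ c ∈ C, (∃ k ∈ K, dist c k < ℓ) → (∀ k ∈ K, rI < dist c k) → ∃ p ∈ S, dist p c ≤ ε)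
    (hlab : IsBondLabel ε rΘ ℓ S K C lab) {c : E3} (hc : c ∈ C) (hcK : ∃ k ∈ K, dist c k ≤ rI) :
    ∃ p ∈ S, (∃ k ∈ K, dist p k < ℓ) ∧ lab p = c := by
  obtain ⟨k₀, hk₀, hck₀⟩ := hcK
  obtain ⟨f, hf⟩ := exists_labelRead hΨ hsurjΦ hlab
  obtain ⟨hinj, hhom⟩ := labelRead_props hΨ hΦ hlab hf
  obtain ⟨yc, rfl⟩ := hsurjΦ c hc
  set G : ℝ := rI + q with hG
  have hycG : dist (Φ yc) x₀ ≤ G + 28 / 25 := by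
    rw [hG]; linarith [dist_triangle (Φ yc) k₀ x₀, hKq k₀ hk₀]
  obtain ⟨z, hzG, hzV, hpath⟩ := exists_path_outward' (G := G) hΦ hsurjΦ hcleanC hσ hsepC hycG
  -- zone bookkeeping
  have hzone : ∀ p : E3, dist p x₀ ≤ G + 2 * (28 / 25) + ε → ∃ k ∈ K, dist p k < ℓ := fun p hp =>
    ⟨k₀, hk₀, by rw [hG] at hp; linarith [dist_triangle p x₀ k₀, hKq k₀ hk₀, dist_comm x₀ k₀]⟩
  -- LOCALISATION FOR FREE: a zone atom labelled by a site within `G + 28/25` of `x₀` is within `G + 28/25 + ε` of `x₀`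
  have hB : ∀ x : ℤ × ℤ × ℤ, (∃ k ∈ K, dist (Ψ x) k < ℓ) → dist (Φ (f x)) x₀ ≤ G + 28 / 25 →
      dist (Ψ x) x₀ ≤ G + 28 / 25 + ε := by
    intro x hxz hfx
    by_cases hcool : ∀ k ∈ K, rΘ < dist (Ψ x) k
    · have h1 : dist (Ψ x) (lab (Ψ x)) ≤ ε := hlab.2.2.2 _ (hΨ.2.1 (mem_univ x)) hxz hcool
      rw [← hf x hxz] at h1
      linarith [dist_triangle (Ψ x) (Φ (f x)) x₀]
    · push Not at hcool
      obtain ⟨k, hk, hxk⟩ := hcool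
      have : dist (Ψ x) x₀ ≤ rΘ + q := by linarith [dist_triangle (Ψ x) k x₀, hKq k hk]
      rw [hG]; linarith
  have hlink : ∀ a : ℤ × ℤ × ℤ, ∀ i, dist (Ψ a) (Ψ (linkPt τS a i)) ≤ 28 / 25 := fun a i =>
    ((hΨ.2.2 a (mem_univ _) _ (mem_univ _)).2 (barlowAdj_linkPt τS a i)).2
  have hstar : ∀ x : ℤ × ℤ × ℤ, dist (Ψ x) x₀ ≤ G + 28 / 25 + ε →
      (∃ k ∈ K, dist (Ψ x) k < ℓ) ∧ ∀ i, ∃ k ∈ K, dist (Ψ (linkPt τS x i)) k < ℓ := fun x hx =>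
    ⟨hzone _ (by linarith), fun i =>
      hzone _ (by linarith [dist_triangle (Ψ (linkPt τS x i)) (Ψ x) x₀, hlink x i, dist_comm (Ψ x) (Ψ (linkPt τS x i))])⟩
  -- the start of the lift: the REG-in partner of the cool site `Φ z`
  have hzk : ∀ k ∈ K, rI < dist (Φ z) k := fun k hk => by
    have h1 := dist_triangle (Φ z) k x₀
    have h2 := hKq k hk
    rw [hG] at hzG
    linarith
  have hzℓ : ∃ k ∈ K, dist (Φ z) k < ℓ := hzone _ (by linarith)
  obtain ⟨p₀, hp₀S, hp₀⟩ := hin _ (hΦ.2.1 (mem_univ z)) hzℓ hzk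
  obtain ⟨xz, rfl⟩ := hsurjΨ p₀ hp₀S
  have hxz_zone : ∃ k ∈ K, dist (Ψ xz) k < ℓ := hzone _ (by linarith [dist_triangle (Ψ xz) (Φ z) x₀])
  have hxz_cool : ∀ k ∈ K, rΘ < dist (Ψ xz) k := fun k hk => by
    have h1 := hzk k hk
    have h2 := dist_triangle (Φ z) (Ψ xz) k
    rw [dist_comm (Φ z) (Ψ xz)] at h2
    linarith
  have hfz : f xz = z := by
    have h1 : dist (Ψ xz) (lab (Ψ xz)) ≤ ε := hlab.2.2.2 _ hp₀S hxz_zone hxz_cool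
    have hC1 : lab (Ψ xz) ∈ C := hlab.1 _ hp₀S hxz_zone
    have heq : lab (Ψ xz) = Φ z := by
      by_contra hne
      have := hsepC _ hC1 _ (hΦ.2.1 (mem_univ z)) hne
      linarith [dist_triangle_left (lab (Ψ xz)) (Φ z) (Ψ xz)]
    apply hΦ.1 (mem_univ _) (mem_univ _)
    rw [hf xz hxz_zone, heq]
  -- lift back along the reversed walk, one link at a time
  have hrev := reflTransGen_reverse
    (R := fun a b => dist (Φ a) x₀ ≤ G + 28 / 25 ∧ dist (Φ b) x₀ ≤ G + 28 / 25 ∧ BarlowAdj τC a b)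
    (fun a b h => ⟨h.2.1, h.1, barlowAdj_symm h.2.2⟩) hpath
  have key : ∀ y, Relation.ReflTransGen
      (fun a b => dist (Φ a) x₀ ≤ G + 28 / 25 ∧ dist (Φ b) x₀ ≤ G + 28 / 25 ∧ BarlowAdj τC a b) z y →
      ∃ x : ℤ × ℤ × ℤ, (∃ k ∈ K, dist (Ψ x) k < ℓ) ∧ f x = y := by
    intro y hy
    induction hy with
    | refl => exact ⟨xz, hxz_zone, hfz⟩
    | @tail b b' _ hbc ih =>
      obtain ⟨x, hxzone, hfx⟩ := ih
      have hxB := hB x hxzone (by rw [hfx]; exact hbc.1)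
      obtain ⟨hxz', hlinks⟩ := hstar x hxB
      have hSH : IsStarHom τS τC f x :=
        isStarHom_of_hom (R := {x : ℤ × ℤ × ℤ | ∃ k ∈ K, dist (Ψ x) k < ℓ}) hxz' hlinks hinj hhom
      have hadj : BarlowAdj τC (f x) b' := by rw [hfx]; exact hbc.2.2
      obtain ⟨i, hi⟩ := hSH.exists_link_preimage hadj
      exact ⟨linkPt τS x i, hlinks i, hi⟩
  obtain ⟨x, hxzone, hfx⟩ := key yc hrev
  exact ⟨Ψ x, hΨ.2.1 (mem_univ x), hxzone, by rw [← hf x hxzone, hfx]⟩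

/-- ★★★ **EVERY DEEP SITE IS THE LABEL OF A CORE ATOM** (`rΘ ≤ rm`, `rI + ε ≤ rm`: an atom farther than `rm` from all of `K` is cool, hence within
`ε` of its label, which is then not deep). [this file, g83] -/
theorem exists_core_preimage_of_bondLabel {S K C : Set E3} {Ψ Φ : ℤ × ℤ × ℤ → E3} {τS τC : ℤ → Bool} {x₀ : E3}
    {σC ε rΘ rI rm ℓ q : ℝ} {lab : E3 → E3}
    (hΨ : IsBarlowBondChart S Set.univ Ψ τS) (hsurjΨ : ∀ p ∈ S, ∃ x, Ψ x = p)
    (hΦ : IsBarlowBondChart C Set.univ Φ τC) (hsurjΦ : ∀ c ∈ C, ∃ y, Φ y = c)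
    (hcleanC : ∀ c ∈ C, IsTwoShellGoodSet (1 / 15) (8999 / 10000) 1 C c) (hσ : 0 < σC) (hsepC : IsSep σC C)
    (hε₀ : 0 ≤ ε) (hε : 2 * ε < σC) (hKq : ∀ k ∈ K, dist k x₀ ≤ q) (hrΘ : rΘ + ε ≤ rI)
    (hdial : rI + 2 * q + 2 * (28 / 25) + ε < ℓ) (hrm : rI + ε ≤ rm) (hrmΘ : rΘ ≤ rm)
    (hin : ∀ c ∈ C, (∃ k ∈ K, dist c k < ℓ) → (∀ k ∈ K, rI < dist c k) → ∃ p ∈ S, dist p c ≤ ε)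
    (hlab : IsBondLabel ε rΘ ℓ S K C lab) {c : E3} (hc : c ∈ C) (hcK : ∃ k ∈ K, dist c k ≤ rI) :
    ∃ p ∈ coreOf S K rm, lab p = c := by
  obtain ⟨p, hpS, hpz, hpc⟩ :=
    exists_zone_preimage_of_bondLabel hΨ hsurjΨ hΦ hsurjΦ hcleanC hσ hsepC hε₀ hε hKq hrΘ hdial hin hlab hc hcK
  obtain ⟨k₀, hk₀, hck₀⟩ := hcK
  refine ⟨p, ⟨hpS, ?_⟩, hpc⟩
  by_contra hfar
  push Not at hfar
  have hcool : ∀ k ∈ K, rΘ < dist p k := fun k hk => lt_of_le_of_lt hrmΘ (hfar k hk)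
  have h1 : dist p (lab p) ≤ ε := hlab.2.2.2 p hpS hpz hcool
  rw [hpc] at h1
  have h2 := hfar k₀ hk₀
  linarith [dist_triangle p c k₀]

end Summit.AtomisticToContinuum.Crystallization.Theorems.ChartedZeroExcessLayeredLatticeLiouville

end
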